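import Summits.SmoothPoincare4.SmoothPoincare4.Theorems.OrigamiFoldExistence.Negative.ZeroSlack

/-!
# Sketch — crux idea `periodic-pages` for `OrigamiFoldExistence` (stmt-SmoothPoincare4-7844), round 2, ideator 5

First-lemma certificates (Props only, no proofs, no sorries): the vocabulary of PERIODIC PAGE CHARTS
(fake balls as pages of the contactisation `(ℝ⁴ × ℝ, ds + λ₀)` swept ℤ-periodically), the
π₁-consuming existence statement (Θ₄ = 0 + 6-dimensional s-cobordism theorem), the rung-0
recogniser (Reeb-transverse sweep-out ⇒ standard), the one-wrinkle rung, the page-convexity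
recogniser (Giroux normal form + Etnyre/McDuff boundary connectivity + Gromov–McDuff), and the
transfer statement C⁺.
-/

noncomputable section

set_option linter.dupNamespace false

open scoped Manifold ContDiff Topology ContinuousMap
open Literature.Geometry.Symplectic

namespace Summit.SmoothPoincare4.SmoothPoincare4.Cruxes.OrigamiFoldExistence.PeriodicPages

/-- Local notation for the model space `ℝ⁴`. -/
local notation "E4" => EuclideanSpace ℝ (Fin 4)
/-- Local notation for the round 4-sphere. -/
local notation "𝕊⁴" => Metric.sphere (0 : EuclideanSpace ℝ (Fin 5)) 1

/-- The standard Liouville form `λ₀ = ½ (y₀ dy₁ − y₁ dy₀ + y₂ dy₃ − y₃ dy₂)` on `ℝ⁴`, evaluated at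
the point `y` on the vector `w`; `dλ₀ = ω₀ = stdSymplecticForm`. -/
def stdLiouville (y w : E4) : ℝ :=
  (1 / 2) * (y 0 * w 1 - y 1 * w 0 + y 2 * w 3 - y 3 * w 2)

/-- The standard contact form `α = ds + λ₀` of the contactisation `ℝ⁴ × ℝ_s` of `(ℝ⁴, λ₀)`,
at the point `q = (y, s)` on the tangent vector `w = (w_y, w_s)`. Its Reeb field is `∂_s = (0, 1)`. -/
def contactForm (q w : E4 × ℝ) : ℝ :=
  w.2 + stdLiouville q.1 w.1

/-- `X` is a CONTACT VECTOR FIELD for `α = ds + λ₀`: smooth and `L_X α = μ • α` for some function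
`μ`, written out as `d(α(X))(w) + dα(X, w) = μ α(w)` with `dα = ω₀` on the `ℝ⁴`-components. -/
def IsContactVectorField (X : E4 × ℝ → E4 × ℝ) : Prop :=
  ContDiff ℝ ∞ X ∧ ∃ μ : E4 × ℝ → ℝ, ∀ q w : E4 × ℝ,
    fderiv ℝ (fun q' => contactForm q' (X q')) q w + stdSymplecticForm (X q).1 w.1 =
      μ q * contactForm q w

variable {M : Type} [TopologicalSpace M] [T2Space M] [SecondCountableTopology M]
  [ChartedSpace E4 M] [IsManifold (𝓡 4) ∞ M]

/-- A PERIODIC PAGE CHART at `p ∈ M`: a diffeomorphism `Φ : (M ∖ p) × ℝ → ℝ⁴ × ℝ` which is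
ℤ-equivariant for the unit translations of the `ℝ`-factors and which, near the puncture, is the
inverted recentred chart times the identity. Its FIBRES `Φ((M ∖ p) × {t})` are the pages: copies
of the punctured manifold, flat (`= ℝ⁴ × {t}`) outside a compact set, sweeping `ℝ⁴ × ℝ`
periodically; the compact parts are copies of the fake ball `Δ = M ∖ ball` sweeping the solid
cylinder `B⁴ × ℝ`. -/
def IsPeriodicPageChart (p : M)
    (Φ : (punctured p × ℝ) ≃ₘ⟮(𝓡 4).prod 𝓘(ℝ, ℝ), (𝓡 4).prod 𝓘(ℝ, ℝ)⟯ (E4 × ℝ)) : Prop :=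
  (∀ (x : punctured p) (t : ℝ), Φ (x, t + 1) = Φ (x, t) + (0, 1)) ∧
  ∃ ε : ℝ, 0 < ε ∧ ∀ (x : punctured p) (t : ℝ), x.1 ∈ (chartAt E4 p).source →
    extChartAt (𝓡 4) p x.1 ∈ Metric.ball (extChartAt (𝓡 4) p p) ε →
      Φ (x, t) = (inversion (extChartAt (𝓡 4) p x.1 - extChartAt (𝓡 4) p p), t)

/-- **L1 — EXISTENCE (the π₁-consuming step; a THEOREM in print).** Every smooth homotopy 4-sphere
admits a periodic page chart at every point. Paper proof: `Θ₄ = 0` (tree fact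
`isHCobordant_sphere_of_homotopySphere_four`) gives an h-cobordism `W⁵ : S⁴ ∼ M`; `W × S¹` is a
6-dimensional h-cobordism with `π₁ = ℤ`, `Wh(ℤ) = 0` (Bass–Heller–Swan), hence a product by the
s-cobordism theorem (Juhász 2023 Thm 2.19): `M × S¹ ≅ S⁴ × S¹`; isotope the image of `p × S¹` to
a standard circle, straighten the tubular neighbourhood (`π₁ SO(4) = ℤ/2` extends over the ball)
and the collar, lift to the infinite cyclic covers. FAILS for Kervaire's homology 4-spheres
(`π₁ ≠ 1`): no fibration of `B⁴ × S¹` over `S¹` has a non-simply-connected fibre. -/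
def PeriodicPagesExist : Prop :=
  ∀ (M : Type) [TopologicalSpace M] [T2Space M] [SecondCountableTopology M]
    [ChartedSpace E4 M] [IsManifold (𝓡 4) ∞ M], M ≃ₕ 𝕊⁴ → ∀ p : M,
    ∃ Φ : (punctured p × ℝ) ≃ₘ⟮(𝓡 4).prod 𝓘(ℝ, ℝ), (𝓡 4).prod 𝓘(ℝ, ℝ)⟯ (E4 × ℝ),
      IsPeriodicPageChart p Φ

/-- **L2 — RUNG 0 (provable now, no symplectic input).** If some periodic page chart at `p` has
REEB-TRANSVERSE pages — the sweep-out function `D = pr₂ ∘ Φ⁻¹` is strictly increasing along every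
Reeb orbit `{y} × ℝ` — then `M ≅ S⁴`: each page is then a graph over `ℝ⁴`, so `pr₁ ∘ Φ(·, 0)` is a
diffeomorphism `M ∖ p → ℝ⁴` agreeing with the inverted chart near `p`, and
`nonempty_diffeomorph_sphere_of_agreesWithInvertedChartNear` (tree, proved) concludes. In Giroux's
language (Breen–Honda–Huang 2023, Def 1.1.1 (3)): Reeb-transverse ⟺ all pages Liouville. -/
def ReebTransverseSweepoutStandard : Prop :=
  ∀ (M : Type) [TopologicalSpace M] [T2Space M] [SecondCountableTopology M]
    [ChartedSpace E4 M] [IsManifold (𝓡 4) ∞ M], M ≃ₕ 𝕊⁴ → ∀ (p : M)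
    (Φ : (punctured p × ℝ) ≃ₘ⟮(𝓡 4).prod 𝓘(ℝ, ℝ), (𝓡 4).prod 𝓘(ℝ, ℝ)⟯ (E4 × ℝ)),
    IsPeriodicPageChart p Φ →
    (∀ (y : E4) (s : ℝ), 0 < deriv (fun s' : ℝ => (Φ.symm (y, s')).2) s) →
      Nonempty (M ≃ₘ⟮𝓡 4, 𝓡 4⟯ 𝕊⁴)

/-- **L3 — ONE-WRINKLE RUNG (new, exotica-free, open).** If some periodic page chart at `p` has a
sweep-out function with AT MOST TWO critical points per period on every Reeb orbit (ONE WRINKLE = one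
max–min pair per period; when the wrinkle amplitude is `< 1` this says exactly that each page meets
each vertical line in `≤ 3` points — at most one pleat over every point of `ℝ⁴`, the family form of
the one-pleat ironing of line shadow-pleats; amplitude `≥ 1` lets one wrinkle wrap a page several
times around the `S¹`-direction and is the new case), then `M ≅ S⁴`. `Set.encard` makes an orbit
with infinitely many critical points violate the hypothesis (no junk truth). -/
def OneWrinkleRung : Prop :=
  ∀ (M : Type) [TopologicalSpace M] [T2Space M] [SecondCountableTopology M]
    [ChartedSpace E4 M] [IsManifold (𝓡 4) ∞ M], M ≃ₕ 𝕊⁴ → ∀ (p : M)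
    (Φ : (punctured p × ℝ) ≃ₘ⟮(𝓡 4).prod 𝓘(ℝ, ℝ), (𝓡 4).prod 𝓘(ℝ, ℝ)⟯ (E4 × ℝ)),
    IsPeriodicPageChart p Φ →
    (∀ (y : E4) (a : ℝ),
      {s : ℝ | s ∈ Set.Ico a (a + 1) ∧ deriv (fun s' : ℝ => (Φ.symm (y, s')).2) s = 0}.encard ≤ 2) →
      Nonempty (M ≃ₘ⟮𝓡 4, 𝓡 4⟯ 𝕊⁴)

/-- The page `F₀ = Φ((M ∖ p) × {0})` is PAGE-CONVEX: some contact vector field `X` of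
`(ℝ⁴ × ℝ, ds + λ₀)`, equal to the Reeb field `∂_s` outside a compact set (where the page is the
flat `ℝ⁴ × {0}`), is nowhere tangent to the page. -/
def IsPageConvex (p : M)
    (Φ : (punctured p × ℝ) ≃ₘ⟮(𝓡 4).prod 𝓘(ℝ, ℝ), (𝓡 4).prod 𝓘(ℝ, ℝ)⟯ (E4 × ℝ))
    (X : E4 × ℝ → E4 × ℝ) : Prop :=
  IsContactVectorField X ∧
  (∃ R : ℝ, ∀ q : E4 × ℝ, R ≤ ‖q.1‖ → X q = (0, 1)) ∧
  ∀ x : punctured p, X (Φ (x, 0)) ∉ Set.range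
    (fun v : TangentSpace (𝓡 4) x =>
      mfderiv ((𝓡 4).prod 𝓘(ℝ, ℝ)) ((𝓡 4).prod 𝓘(ℝ, ℝ)) Φ (x, 0) (v, (0 : ℝ)))

/-- **L4 — PAGE RECOGNITION (the recogniser; in print modulo assembly).** A homotopy 4-sphere with
a page-convex periodic page is `S⁴` (given Cerf's `Γ₄ = 0` for the final gluing). Paper proof:
Giroux's normal form `α = u ds + β` along the convex page; the collar/flat end lies in `R₊ = {u>0}`
where `β/u` is a Liouville form with radial (outward) Liouville field at large `‖y‖`; truncating,
`R₊` is an exact symplectic 4-manifold with convex boundary `(S³, ξ_std) ⊔ Γ_δ`; `(S³, ξ_std)` is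
planar, so the boundary is CONNECTED (Etnyre 2004 Thm 4.1; McDuff 1991 for `S³`): `Γ = ∅`, the
compact page is an exact filling of `(S³, ξ_std)`, hence `B⁴` (Gromov 1985, McDuff 1990 Thm 1.7);
glue the chart ball back: a twisted sphere, `S⁴` by `Γ₄ = 0`. -/
def PageConvexStandard : Prop :=
  Summit.SmoothPoincare4.SmoothPoincare4.Theses.SymplecticOrigami.CerfGammaFour →
  ∀ (M : Type) [TopologicalSpace M] [T2Space M] [SecondCountableTopology M]
    [ChartedSpace E4 M] [IsManifold (𝓡 4) ∞ M], M ≃ₕ 𝕊⁴ → ∀ (p : M)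
    (Φ : (punctured p × ℝ) ≃ₘ⟮(𝓡 4).prod 𝓘(ℝ, ℝ), (𝓡 4).prod 𝓘(ℝ, ℝ)⟯ (E4 × ℝ))
    (X : E4 × ℝ → E4 × ℝ), IsPeriodicPageChart p Φ → IsPageConvex p Φ X →
      Nonempty (M ≃ₘ⟮𝓡 4, 𝓡 4⟯ 𝕊⁴)

/-- **C⁺ — THE TRANSFER (⟺ SPC4, zero slack as for every statement on this crux).** Every homotopy
4-sphere has, at some point, a periodic page chart with a page-convex page. With L4 and the landed
transport `Negative.foldData_transport` + `RoundSphereIsOrigamiFold` it gives the crux. -/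
def PeriodicPageConvexifiable : Prop :=
  ∀ (M : Type) [TopologicalSpace M] [T2Space M] [SecondCountableTopology M]
    [ChartedSpace E4 M] [IsManifold (𝓡 4) ∞ M], M ≃ₕ 𝕊⁴ → ∃ (p : M)
    (Φ : (punctured p × ℝ) ≃ₘ⟮(𝓡 4).prod 𝓘(ℝ, ℝ), (𝓡 4).prod 𝓘(ℝ, ℝ)⟯ (E4 × ℝ))
    (X : E4 × ℝ → E4 × ℝ), IsPeriodicPageChart p Φ ∧ IsPageConvex p Φ X

/-- Bookkeeping (pure logic): the transfer plus the recogniser decide every homotopy 4-sphere. -/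
theorem forall_nonempty_diffeomorph_of (hC : PeriodicPageConvexifiable) (hR : PageConvexStandard)
    (hΓ : Summit.SmoothPoincare4.SmoothPoincare4.Theses.SymplecticOrigami.CerfGammaFour)
    (M : Type) [TopologicalSpace M] [T2Space M] [SecondCountableTopology M]
    [ChartedSpace E4 M] [IsManifold (𝓡 4) ∞ M] (e : M ≃ₕ 𝕊⁴) :
    Nonempty (M ≃ₘ⟮𝓡 4, 𝓡 4⟯ 𝕊⁴) := by
  obtain ⟨p, Φ, X, hΦ, hX⟩ := hC M e
  exact hR hΓ M e p Φ X hΦ hX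

/-- Bookkeeping (pure logic, kernel-checked): transfer + recogniser + `Γ₄ = 0` + the proved
round-sphere instance give the crux BY NAME, through the landed transport
`Negative.foldData_transport` (`origamiFoldExistence_of_smoothPoincare4`). -/
theorem origamiFoldExistence_of (hC : PeriodicPageConvexifiable) (hR : PageConvexStandard)
    (hΓ : Summit.SmoothPoincare4.SmoothPoincare4.Theses.SymplecticOrigami.CerfGammaFour)
    (hRS : Summit.SmoothPoincare4.SmoothPoincare4.Theses.SymplecticOrigami.RoundSphereIsOrigamiFold) :
    Summit.SmoothPoincare4.SmoothPoincare4.Theses.SymplecticOrigami.OrigamiFoldExistence := by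
  refine Summit.SmoothPoincare4.SmoothPoincare4.Theorems.OrigamiFoldExistence.Negative.origamiFoldExistence_of_smoothPoincare4 ?_ hRS
  unfold _root_.SmoothPoincare4 Literature.SPC4.SmoothPoincareConjectureFour
    ContinuousMap.HomotopyEquiv.NonemptyDiffeomorphSphere
  intro M _ _ _ _ _ e
  exact forall_nonempty_diffeomorph_of hC hR hΓ M e

end Summit.SmoothPoincare4.SmoothPoincare4.Cruxes.OrigamiFoldExistence.PeriodicPages

end
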